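import Mathlib.Algebra.Order.BigOperators.Group.Finset
import Mathlib.Data.Finset.Card
import Mathlib.Logic.Function.Basic
import HarnessLib

/-!
# The product lemma for hub structures (Kleitman's induction step, abstracted) — glue for H≼_J on bundles

Support file (`--supports stmt-CriticalPhenomena-4575`, closed), prover `prim-cplus-coupling` (gen 51).  No definitions, no notations,
no named facts, no sorries; standard axioms.  Memo `prim-cplus-coupling/A5-COUPLING-gen50.md` §2.6 (PRODUCT LEMMA), `A5-COUPLING-gen51.md` §3, §7(2).

HUB STRUCTURES (memo-50 §2.6).  A 'hub structure' is a set `Ω` with a relation `≼` (the hub-grown order), an involution `c` (complementation)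
and a class `𝒞` of subsets; property `H(Ω, 𝒞)`: for every `W ∈ 𝒞` and every `≼`-up-set `F`, `#(F ∩ W) ≤ #(F ∩ cW)`.
PRODUCT LEMMA (`hubProduct_card_le`).  On `Ω₁ × Ω₂` with the product relation and `c = c₁ × c₂`: if `H(Ω₁, 𝒞₁)` and `H(Ω₂, 𝒞₂)` hold and
`W ⊆ Ω₁ × Ω₂` has all its nonempty `Ω₁`-slices `W_ζ = {ω₁ : (ω₁, ζ) ∈ W}` in `𝒞₁` and all its nonempty `Ω₂`-slices `W^{ω₁}` in `𝒞₂`, then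
`#(𝒰 ∩ W) ≤ #(𝒰 ∩ cW)` for every up-set `𝒰` of the product relation (reflexivity of the two relations is what makes slices of up-sets up-sets).
Proof (memo-50 §2.6, verbatim): `#(𝒰 ∩ W) = Σ_{ω₁} #(F_{ω₁} ∩ W^{ω₁}) ≤ Σ_{ω₁} #(F_{ω₁} ∩ c₂W^{ω₁})` (by `H(Ω₂)`, `F_{ω₁} = {ζ : (ω₁,ζ) ∈ 𝒰}`)
`= #{(ω₁,ζ) ∈ 𝒰 : (ω₁, c₂ζ) ∈ W} = Σ_ζ #(𝒰_ζ ∩ W_{c₂ζ}) ≤ Σ_ζ #(𝒰_ζ ∩ c₁W_{c₂ζ})` (by `H(Ω₁)`) `= #(𝒰 ∩ cW)`.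
For `Ω₂ = {B < R}`, `c₂` the swap, this is exactly Kleitman's induction step; with the CLOSURE LEMMA (memo-50 §2.6, bundles glued at
`{u,b}`) and the PATH LEMMA (memo-51 §2, Lean: `…KernelMixHubClosed`) it gives H≼_J for every bundle `Θ(ℓ₁,…,ℓ_r)`.
Everything is stated for `Finset`s of a product type with the classes as predicates; no order structure is assumed.
[cite: KozmaNitzan2024, Questions 8–9 (§5.5 p. 36) (context); Kleitman 1966 (the star case)]
-/

namespace Summit.CriticalPhenomena.PercolationContinuityZ3.Theorems

open Finset

namespace Coefficientwise

variable {α β : Type*}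

/-- Membership in an image under an involution. [folklore] -/
theorem hubProd_mem_image_invol {γ : Type*} [DecidableEq γ] (c : γ → γ) (hc : Function.Involutive c) (s : Finset γ)
    (x : γ) : x ∈ s.image c ↔ c x ∈ s := by
  constructor
  · intro h
    obtain ⟨y, hy, hyx⟩ := Finset.mem_image.mp h
    rw [← hyx, hc y]
    exact hy
  · intro h
    exact Finset.mem_image.mpr ⟨c x, h, hc x⟩

/-- The `Ω₂`-slice of a set of pairs at a first coordinate. [folklore] -/
theorem hubProd_mem_sliceSnd [DecidableEq α] [DecidableEq β] (P : Finset (α × β)) (a : α) (z : β) :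
    z ∈ (P.filter (fun p => p.1 = a)).image Prod.snd ↔ (a, z) ∈ P := by
  constructor
  · intro h
    obtain ⟨p, hp, hpz⟩ := Finset.mem_image.mp h
    obtain ⟨hpP, hpa⟩ := Finset.mem_filter.mp hp
    have : p = (a, z) := Prod.ext hpa hpz
    rw [this] at hpP
    exact hpP
  · intro h
    exact Finset.mem_image.mpr ⟨(a, z), Finset.mem_filter.mpr ⟨h, rfl⟩, rfl⟩

/-- The `Ω₁`-slice of a set of pairs at a second coordinate. [folklore] -/
theorem hubProd_mem_sliceFst [DecidableEq α] [DecidableEq β] (P : Finset (α × β)) (a : α) (z : β) :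
    a ∈ (P.filter (fun p => p.2 = z)).image Prod.fst ↔ (a, z) ∈ P := by
  constructor
  · intro h
    obtain ⟨p, hp, hpa⟩ := Finset.mem_image.mp h
    obtain ⟨hpP, hpz⟩ := Finset.mem_filter.mp hp
    have : p = (a, z) := Prod.ext hpa hpz
    rw [this] at hpP
    exact hpP
  · intro h
    exact Finset.mem_image.mpr ⟨(a, z), Finset.mem_filter.mpr ⟨h, rfl⟩, rfl⟩

/-- Counting a set of pairs by first coordinates: `#P = Σ_a #(slice of P at a)`. [folklore] -/
theorem hubProd_card_eq_sum_fst [DecidableEq α] [DecidableEq β] (P : Finset (α × β)) (S : Finset α)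
    (hS : ∀ p ∈ P, p.1 ∈ S) :
    P.card = ∑ a ∈ S, ((P.filter (fun p => p.1 = a)).image Prod.snd).card := by
  rw [Finset.card_eq_sum_card_fiberwise (f := Prod.fst) (t := S) (fun p hp => hS p hp)]
  refine Finset.sum_congr rfl fun a _ => ?_
  rw [Finset.card_image_of_injOn]
  intro p hp q hq h
  have hp' := (Finset.mem_filter.mp (Finset.mem_coe.mp hp)).2
  have hq' := (Finset.mem_filter.mp (Finset.mem_coe.mp hq)).2
  exact Prod.ext (hp'.trans hq'.symm) h

/-- Counting a set of pairs by second coordinates: `#P = Σ_z #(slice of P at z)`. [folklore] -/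
theorem hubProd_card_eq_sum_snd [DecidableEq α] [DecidableEq β] (P : Finset (α × β)) (S : Finset β)
    (hS : ∀ p ∈ P, p.2 ∈ S) :
    P.card = ∑ z ∈ S, ((P.filter (fun p => p.2 = z)).image Prod.fst).card := by
  rw [Finset.card_eq_sum_card_fiberwise (f := Prod.snd) (t := S) (fun p hp => hS p hp)]
  refine Finset.sum_congr rfl fun z _ => ?_
  rw [Finset.card_image_of_injOn]
  intro p hp q hq h
  have hp' := (Finset.mem_filter.mp (Finset.mem_coe.mp hp)).2
  have hq' := (Finset.mem_filter.mp (Finset.mem_coe.mp hq)).2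
  exact Prod.ext h (hp'.trans hq'.symm)

/-- **PRODUCT LEMMA for hub structures** (memo-50 §2.6; Kleitman's induction step abstracted).  If `H(Ω₁, 𝒞₁)` and `H(Ω₂, 𝒞₂)`
hold, the relations are reflexive, `c₁`, `c₂` are involutions, and the nonempty slices of `W` lie in the classes, then
`#(𝒰 ∩ W) ≤ #(𝒰 ∩ (c₁ × c₂) W)` for every up-set `𝒰` of the product relation. [folklore] -/
theorem hubProduct_card_le [DecidableEq α] [DecidableEq β]
    (r₁ : α → α → Prop) (r₂ : β → β → Prop) (hr₁ : ∀ x, r₁ x x) (hr₂ : ∀ y, r₂ y y)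
    (c₁ : α → α) (c₂ : β → β) (hc₁ : Function.Involutive c₁) (hc₂ : Function.Involutive c₂)
    (C₁ : Finset α → Prop) (C₂ : Finset β → Prop)
    (H₁ : ∀ W F : Finset α, C₁ W → (∀ x y, r₁ x y → x ∈ F → y ∈ F) → (F ∩ W).card ≤ (F ∩ W.image c₁).card)
    (H₂ : ∀ W F : Finset β, C₂ W → (∀ x y, r₂ x y → x ∈ F → y ∈ F) → (F ∩ W).card ≤ (F ∩ W.image c₂).card)
    (W U : Finset (α × β))
    (hW₁ : ∀ z ∈ W.image Prod.snd, C₁ ((W.filter (fun p => p.2 = z)).image Prod.fst))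
    (hW₂ : ∀ a ∈ W.image Prod.fst, C₂ ((W.filter (fun p => p.1 = a)).image Prod.snd))
    (hU : ∀ p q : α × β, r₁ p.1 q.1 → r₂ p.2 q.2 → p ∈ U → q ∈ U) :
    (U ∩ W).card ≤ (U ∩ W.image (Prod.map c₁ c₂)).card := by
  classical
  -- slices of 𝒰 and W (opaque names with defining equations)
  obtain ⟨F, hF⟩ : ∃ F : α → Finset β, ∀ a, F a = (U.filter (fun p => p.1 = a)).image Prod.snd := ⟨_, fun _ => rfl⟩
  obtain ⟨Hs, hHs⟩ : ∃ Hs : α → Finset β, ∀ a, Hs a = (W.filter (fun p => p.1 = a)).image Prod.snd := ⟨_, fun _ => rfl⟩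
  obtain ⟨G, hG⟩ : ∃ G : β → Finset α, ∀ z, G z = (U.filter (fun p => p.2 = z)).image Prod.fst := ⟨_, fun _ => rfl⟩
  obtain ⟨K, hK⟩ : ∃ K : β → Finset α, ∀ z, K z = (W.filter (fun p => p.2 = c₂ z)).image Prod.fst := ⟨_, fun _ => rfl⟩
  have mF : ∀ a z, z ∈ F a ↔ (a, z) ∈ U := fun a z => by rw [hF]; exact hubProd_mem_sliceSnd U a z
  have mH : ∀ a z, z ∈ Hs a ↔ (a, z) ∈ W := fun a z => by rw [hHs]; exact hubProd_mem_sliceSnd W a z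
  have mG : ∀ a z, a ∈ G z ↔ (a, z) ∈ U := fun a z => by rw [hG]; exact hubProd_mem_sliceFst U a z
  have mK : ∀ a z, a ∈ K z ↔ (a, c₂ z) ∈ W := fun a z => by rw [hK]; exact hubProd_mem_sliceFst W a (c₂ z)
  -- the middle set M = {(a, z) ∈ 𝒰 : (a, c₂ z) ∈ W}
  obtain ⟨M, hM⟩ : ∃ M : Finset (α × β), M = U.filter (fun p => (p.1, c₂ p.2) ∈ W) := ⟨_, rfl⟩
  have mM : ∀ a z, (a, z) ∈ M ↔ (a, z) ∈ U ∧ (a, c₂ z) ∈ W := fun a z => by rw [hM, Finset.mem_filter]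
  -- (1) #(𝒰 ∩ W) = Σ_a #(F a ∩ Hs a)
  have e1 : (U ∩ W).card = ∑ a ∈ U.image Prod.fst, (F a ∩ Hs a).card := by
    rw [hubProd_card_eq_sum_fst (U ∩ W) (U.image Prod.fst)
      (fun p hp => Finset.mem_image_of_mem _ (Finset.mem_inter.mp hp).1)]
    refine Finset.sum_congr rfl fun a _ => ?_
    congr 1
    ext z
    rw [hubProd_mem_sliceSnd, Finset.mem_inter, Finset.mem_inter, mF, mH]
  -- (2) Σ_a #(F a ∩ Hs a) ≤ Σ_a #(F a ∩ c₂ (Hs a))   [H(Ω₂)]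
  have e2 : ∑ a ∈ U.image Prod.fst, (F a ∩ Hs a).card ≤ ∑ a ∈ U.image Prod.fst, (F a ∩ (Hs a).image c₂).card := by
    refine Finset.sum_le_sum fun a _ => ?_
    by_cases hne : (Hs a).Nonempty
    · obtain ⟨z, hz⟩ := hne
      have haW : a ∈ W.image Prod.fst := Finset.mem_image.mpr ⟨(a, z), (mH a z).mp hz, rfl⟩
      have hC : C₂ (Hs a) := by rw [hHs]; exact hW₂ a haW
      refine H₂ (Hs a) (F a) hC ?_
      intro x y hxy hx
      rw [mF] at hx ⊢
      exact hU (a, x) (a, y) (hr₁ a) hxy hx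
    · rw [Finset.not_nonempty_iff_eq_empty] at hne
      rw [hne, Finset.inter_empty, Finset.card_empty]
      exact Nat.zero_le _
  -- (3) Σ_a #(F a ∩ c₂ (Hs a)) = #M
  have e3 : ∑ a ∈ U.image Prod.fst, (F a ∩ (Hs a).image c₂).card = M.card := by
    rw [hubProd_card_eq_sum_fst M (U.image Prod.fst)
      (fun p hp => Finset.mem_image_of_mem _ (((mM p.1 p.2).mp hp).1))]
    refine Finset.sum_congr rfl fun a _ => ?_
    congr 1
    ext z
    rw [hubProd_mem_sliceSnd, Finset.mem_inter, mF, hubProd_mem_image_invol c₂ hc₂, mH, mM]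
  -- (4) #M = Σ_z #(G z ∩ K z)
  have e4 : M.card = ∑ z ∈ U.image Prod.snd, (G z ∩ K z).card := by
    rw [hubProd_card_eq_sum_snd M (U.image Prod.snd)
      (fun p hp => Finset.mem_image_of_mem _ (((mM p.1 p.2).mp hp).1))]
    refine Finset.sum_congr rfl fun z _ => ?_
    congr 1
    ext a
    rw [hubProd_mem_sliceFst, Finset.mem_inter, mG, mK, mM]
  -- (5) Σ_z #(G z ∩ K z) ≤ Σ_z #(G z ∩ c₁ (K z))   [H(Ω₁)]
  have e5 : ∑ z ∈ U.image Prod.snd, (G z ∩ K z).card ≤ ∑ z ∈ U.image Prod.snd, (G z ∩ (K z).image c₁).card := by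
    refine Finset.sum_le_sum fun z _ => ?_
    by_cases hne : (K z).Nonempty
    · obtain ⟨a, ha⟩ := hne
      have hzW : c₂ z ∈ W.image Prod.snd := Finset.mem_image.mpr ⟨(a, c₂ z), (mK a z).mp ha, rfl⟩
      have hC : C₁ (K z) := by rw [hK]; exact hW₁ (c₂ z) hzW
      refine H₁ (K z) (G z) hC ?_
      intro x y hxy hx
      rw [mG] at hx ⊢
      exact hU (x, z) (y, z) hxy (hr₂ z) hx
    · rw [Finset.not_nonempty_iff_eq_empty] at hne
      rw [hne, Finset.inter_empty, Finset.card_empty]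
      exact Nat.zero_le _
  -- (6) Σ_z #(G z ∩ c₁ (K z)) = #(𝒰 ∩ cW)
  have e6 : ∑ z ∈ U.image Prod.snd, (G z ∩ (K z).image c₁).card = (U ∩ W.image (Prod.map c₁ c₂)).card := by
    rw [hubProd_card_eq_sum_snd (U ∩ W.image (Prod.map c₁ c₂)) (U.image Prod.snd)
      (fun p hp => Finset.mem_image_of_mem _ (Finset.mem_inter.mp hp).1)]
    refine Finset.sum_congr rfl fun z _ => ?_
    congr 1
    ext a
    rw [hubProd_mem_sliceFst, Finset.mem_inter, Finset.mem_inter, mG, hubProd_mem_image_invol c₁ hc₁, mK]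
    have hcm : Function.Involutive (Prod.map c₁ c₂) := fun p => by
      rw [Prod.map_apply, Prod.map_apply, hc₁, hc₂]
    rw [hubProd_mem_image_invol (Prod.map c₁ c₂) hcm, Prod.map_apply]
  calc (U ∩ W).card = ∑ a ∈ U.image Prod.fst, (F a ∩ Hs a).card := e1
    _ ≤ ∑ a ∈ U.image Prod.fst, (F a ∩ (Hs a).image c₂).card := e2
    _ = M.card := e3
    _ = ∑ z ∈ U.image Prod.snd, (G z ∩ K z).card := e4
    _ ≤ ∑ z ∈ U.image Prod.snd, (G z ∩ (K z).image c₁).card := e5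
    _ = (U ∩ W.image (Prod.map c₁ c₂)).card := e6

end Coefficientwise

end Summit.CriticalPhenomena.PercolationContinuityZ3.Theorems
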